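import Summits.QuantumFields.YangMills.Theorems.BalabanUVNodesN26BetaContFiniteRep
import Literature.MathematicalPhysics.QuantumFieldTheory.Balaban1983to89.Node00.Record8

/-!
# DAG node N26 — B4 «β-continuity» AT NODE 00's STAGE-8 RECORD (`Node00.Record8`: `IsRecordOfRecord₈C`, `datumOfRecord₅ F N (θ.toStage5 F N)`
# with `βfun = betaOfRecord₈ F N θ`): the node's statement of record AT `D₀`, knit BY NAME from the (D4) socket of the companions

Cell `pub-ymgap`, YM-PLAN Track A (HUMAN RULING D-0062), seat `pub-ymgap-dag-n26-a` (gen 2; -a = KNIT-BY-NAME); fifth companion of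
`BalabanUVNodesN26BetaCont{Record,Merged,FiniteRep,WallEnd}`.  NODE 00's Stage 8 pins the datum's β-functions: `(datumOfRecord₅ F N (θ.toStage5 F N)).βfun
= betaOfRecord₈ F N θ = betaOfMerged (betaMerged F 𝓝θ θ.ρ8 θ.bV) (beta0OfMerged (betaMerged F 𝓝θ θ.ρ8 θ.bV) θ.v₀) θ.γ` (`rfl`, `Node00.βfun_stage8`) with
`𝓝θ := mergedTermFamilyMat F N (chi7 F N θ) θ.εbg` def-B's merged term family OF RECORD ([I] (1.6), (0.17)–(0.19)).  So the companions' design-(β)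
socket (`BalabanUVNodesN26Merged.atSlopeCont_betaOfMerged`) instantiates AT THE RECORD with ℰ := 𝓝θ, ρ := θ.ρ8, bV := θ.bV, β⁰ := `beta0OfMerged … θ.v₀`,
γ := θ.γ — this file writes that instantiation: `betaContH_datumOfRecord₈_iff` (what B4 IS at D₀), `n26_datumOfRecord₈` (N26's literal at D₀ from the
socket inputs for θ's own objects), `endpoint_and_n26_datumOfRecord₈` (N25's END ∧ N26 at D₀ from (D1)'s residue pinned on the record's one-loop object +
the socket inputs; forward generation = the datum's field `fwd`; `…_onePin`: the (D1) road in the channel (0,1) with `P0 := TbalOf … 0 1`, ONE pin —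
dag-ref-D N-n26-4), `n26_of_isRecordOfRecord₈C` (the record-PREDICATE form: box = the world's window
`]0, w.γ]`, whose positivity and cap `w.γ ≤ θ.γ` are clauses of the predicate).  The carried instances of `Stage8Params` (`instVβ₁ ∕ instVβ₂ ∕ instιβ`) are
re-introduced with `letI` inside the statements, as `Node00.Record8` does (no instance attribute).

HONEST FRAMING.  Bookkeeping by name; NO estimate of Bałaban's series is proved; every input (`P0 ∕ hβ0 ∕ hP0 ∕ A1 ∕ hrep ∕ hleaves ∕ (C-pt)`, the side
conditions, the (D1) residue and pin) is a located hypothesis of NODE O ∕ row (D1) about the record's OWN term family — INSTANCE 0∕1; N25 ∕ N26 NOT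
discharged (N26 VACATED, closes WITH N25).  One finite four-torus programme at fixed ε per run; NOT ℝ⁴, NOT infinite volume, NOT OS, NOT a mass gap, NOT
Clay.  Sources (context): [I] = Balaban1987RG1 Thm 2 p. 259, (1.6)–(1.7) p. 261, (1.20)–(1.22) p. 264, (5.10) p. 293; [II] = Balaban1988RG2Cluster Lemma 3 (2.38) p. 20.
-/

noncomputable section

open scoped Matrix.Norms.L2Operator

namespace Summit.QuantumFields.YangMills.Theorems.BalabanUVNodesN26AtRecord8

open Literature.MathematicalPhysics.QuantumFieldTheory.Balaban1983to89
open Literature.MathematicalPhysics.QuantumFieldTheory.Balaban1983to89.FlowStep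
open Literature.MathematicalPhysics.QuantumFieldTheory.Balaban1983to89.DagBinding (ForwardGenerated EndpointExistence WorldP)
open Literature.MathematicalPhysics.QuantumFieldTheory.Balaban1983to89.T4Continuum (T4Family FiniteEpsData)
open Literature.MathematicalPhysics.QuantumFieldTheory.Balaban1983to89.Node00
open Literature.MathematicalPhysics.QuantumFieldTheory.Balaban1983to89.B13ScaleTransfer (Pt)
open Literature.MathematicalPhysics.QuantumFieldTheory.Balaban1983to89.Beta.RemainderChainLattice
open Literature.MathematicalPhysics.QuantumFieldTheory.Balaban1983to89.Beta.RemainderLimitTorus (LDom limKernel)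
open Literature.MathematicalPhysics.QuantumFieldTheory.Balaban1983to89.Beta.RemainderDecay190
open Literature.MathematicalPhysics.QuantumFieldTheory.Balaban1983to89.Beta.RemainderLocalityHolo (PolLeavesTFac190H)
open Literature.MathematicalPhysics.QuantumFieldTheory.Balaban1983to89.Beta.OneStepKernelFamily (TbalOf)
open Literature.MathematicalPhysics.QuantumFieldTheory.Balaban1983to89.Beta.OneStepResolventKernel (JetData)
open Summit.QuantumFields.BalabanUV.Gaps
open Summit.QuantumFields.BalabanUV.Gaps.BetaContFromD4Chain
open Summit.QuantumFields.YangMills.Theorems.BalabanUVNodesN26Record (betaContH_betaOfMerged_iff)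
open Summit.QuantumFields.YangMills.Theorems.BalabanUVNodesN26Merged (atSlopeCont_betaOfMerged n26lit_betaOfMerged_of_localizedRep)
open Filter Topology

variable (F : T4Family) (N : ℕ) [NeZero N]

/-- **B4 AT THE STAGE-8 DATUM OF RECORD** `datumOfRecord₅ F N (θ.toStage5 F N)` (whose `βfun` IS `betaOfRecord₈ F N θ`, `Node00.βfun_stage8` rfl) on a box
`γc ≤ θ.γ` IS history-continuity there of the MERGED β of record `betaMerged F (mergedTermFamilyMat F N (chi7 F N θ) θ.εbg) θ.ρ8 θ.bV`
(`BalabanUVNodesN26Record.betaContH_betaOfMerged_iff` BY NAME; dag-n28-a's CAP: never above `θ.γ`). [cite: Balaban1987RG1, (1.20)-(1.22) p.264] -/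
theorem betaContH_datumOfRecord₈_iff (θ : Stage8Params F N) {γc : ℝ} (hle : γc ≤ θ.γ) :
    BetaContH γc (datumOfRecord₅ F N (θ.toStage5 F N)).βfun ↔
      letI := θ.instVβ₁; letI := θ.instVβ₂; letI := θ.instιβ
      ∀ k, ContinuousOn (betaMerged F (mergedTermFamilyMat F N (chi7 F N θ) θ.εbg) θ.ρ8 θ.bV k) (Box γc k) := by
  letI := θ.instVβ₁; letI := θ.instVβ₂; letI := θ.instιβ
  rw [βfun_stage8]
  exact betaContH_betaOfMerged_iff _ _ hle

/-- **N26 AT THE STAGE-8 DATUM OF RECORD** from the (D4) socket inputs FOR θ's OWN merged term family `mergedTermFamilyMat F N (chi7 F N θ) θ.εbg`,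
chart `θ.ρ8 ∕ θ.bV` and one-loop object `beta0OfMerged … θ.v₀` on a box `0 < γ₀ ≤ θ.γ`: `hβ0` (the `limUnder (𝓝[>] 0)` one-loop object IS the second
moment of a coupling-free kernel `P0 k` — NODE O's identity under NODE 00's NAMED `Beta0LimitExists`), `hP0` ((5.10) for `P0 k`), the leaf kernels `A1`,
`hrep` (the merged limit kernel splits as `P0 + Σ'_Y A1`), the leaves `hleaves`, the side conditions, (C-pt) ⟹ `∃ γc > 0, BetaContH γc D₀.βfun`
(`BalabanUVNodesN26Merged.n26lit_betaOfMerged_of_localizedRep` BY NAME at the record, `βfun_stage8`).  Every input a located hypothesis of NODE O;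
instance 0∕1; N26 NOT discharged (VACATED, closes WITH N25).
[cite: Balaban1987RG1, (1.7) p.261, (1.20)-(1.22) p.264 and (5.10) p.293; Balaban1988RG2Cluster, Lemma 3 (2.38) p.20] -/
theorem n26_datumOfRecord₈ (θ : Stage8Params F N) {γ₀ : ℝ} (hγ₀ : 0 < γ₀) (hle : γ₀ ≤ θ.γ) {M : ℕ} [NeZero M]
    {c : B13.Consts} {ℓ α₂ : ℝ} {q : Consts190} (P0 : ℕ → Pt 4 → ℝ)
    (hβ0 : letI := θ.instVβ₁; letI := θ.instVβ₂; letI := θ.instιβ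
      ∀ k, beta0OfMerged (betaMerged F (mergedTermFamilyMat F N (chi7 F N θ) θ.εbg) θ.ρ8 θ.bV) θ.v₀ k =
        B12Beta.secondMoment (fun _ _ => P0 k) 0 1)
    (hP0 : ∀ k, ∃ C δ₁ : ℝ, 0 < δ₁ ∧ B12Sec2to5.Decay510 (P0 k) C δ₁)
    (A1 : (k : ℕ) → (Fin (k + 1) → ℝ) → LDom 4 → Pt 4 → ℝ)
    (hrep : letI := θ.instVβ₁; letI := θ.instVβ₂; letI := θ.instιβ
      ∀ k (p : Fin (k + 1) → ℝ), p ∈ Box γ₀ k → ∀ z : Pt 4,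
        polLimit F (k + 1) (fun K => mergedTermFamilyMat F N (chi7 F N θ) θ.εbg k p K) θ.ρ8 θ.bV 0 1 z =
          P0 k z + limKernel (A1 k p) z)
    (hleaves : ∀ k (p : Fin (k + 1) → ℝ), p ∈ Box γ₀ k → PolLeavesTFac190H 4 M (A1 k p) c ℓ α₂ q)
    (hC : CondsL 4 c ℓ) (h22 : c.R22gen ℓ) (hq : q.Valid c.δ₀) (hs : SignsL c α₂ q.B₃)
    (hcont : letI := θ.instVβ₁; letI := θ.instVβ₂; letI := θ.instιβ
      ∀ k (z : Pt 4), ContinuousOn (fun p : Fin (k + 1) → ℝ =>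
        polLimit F (k + 1) (fun K => mergedTermFamilyMat F N (chi7 F N θ) θ.εbg k p K) θ.ρ8 θ.bV 0 1 z) (Box γ₀ k)) :
    ∃ γc : ℝ, 0 < γc ∧ BetaContH γc (datumOfRecord₅ F N (θ.toStage5 F N)).βfun := by
  letI := θ.instVβ₁; letI := θ.instVβ₂; letI := θ.instιβ
  rw [βfun_stage8]
  exact n26lit_betaOfMerged_of_localizedRep F _ θ.ρ8 θ.bV _ hγ₀ hle P0 hβ0 hP0 A1 hrep hleaves hC h22 hq hs hcont

/-- **N25's END ∧ N26 AT THE STAGE-8 DATUM OF RECORD** — «B4 closes WITH B3» at `D₀`: row (D1)'s residue `Gaps.D1Residue.Residue Lc Js Nc μ ν` with its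
identification pinned ON THE RECORD's ONE-LOOP OBJECT (`hβ : beta0OfMerged … θ.v₀ j = Σ_z T̄_j(z) z_μ z_ν`), the socket inputs at the one-loop slope
`ε₁·K_rem,L ≤ stepBal Nc Lc`, `0 < γ₀ ≤ θ.γ` ⟹ `EndpointExistence D₀.C.toB12 ∧ ∃ γc > 0, BetaContH γc D₀.βfun` — forward generation is the datum's
structure field `FiniteEpsData.fwd`, the split is `Node00.oneLoopSplit_stage8` (`Gaps.BetaContFromD4Chain.endpointExistence_of_residue_atSlopeCont` ∘
`BalabanUVNodesN26Merged.atSlopeCont_betaOfMerged` BY NAME).  Instance 0∕1 on rows (D1) and (D4); N25 ∕ N26 NOT discharged.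
[cite: Balaban1987RG1, Thm 2 p.259 (first sentence) and (1.20)-(1.22) p.264; Balaban1988RG2Cluster, Lemma 3 (2.38) p.20] -/
theorem endpoint_and_n26_datumOfRecord₈ (θ : Stage8Params F N) {Lc : ℕ} [NeZero Lc] (Js : ℕ → JetData 3 Lc) {Nc : ℝ}
    {μ ν : Fin 4}
    (hβ : letI := θ.instVβ₁; letI := θ.instVβ₂; letI := θ.instιβ
      ∀ j, beta0OfMerged (betaMerged F (mergedTermFamilyMat F N (chi7 F N θ) θ.εbg) θ.ρ8 θ.bV) θ.v₀ j =
        B12Beta.secondMoment (TbalOf Lc Js j) μ ν)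
    (h1 : D1Residue.Residue Lc Js Nc μ ν) {γ₀ : ℝ} (hγ₀ : 0 < γ₀) (hle : γ₀ ≤ θ.γ) {M : ℕ} [NeZero M]
    {c : B13.Consts} {ℓ α₂ : ℝ} {q : Consts190} (P0 : ℕ → Pt 4 → ℝ)
    (hβ0 : letI := θ.instVβ₁; letI := θ.instVβ₂; letI := θ.instιβ
      ∀ k, beta0OfMerged (betaMerged F (mergedTermFamilyMat F N (chi7 F N θ) θ.εbg) θ.ρ8 θ.bV) θ.v₀ k =
        B12Beta.secondMoment (fun _ _ => P0 k) 0 1)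
    (hP0 : ∀ k, ∃ C δ₁ : ℝ, 0 < δ₁ ∧ B12Sec2to5.Decay510 (P0 k) C δ₁)
    (A1 : (k : ℕ) → (Fin (k + 1) → ℝ) → LDom 4 → Pt 4 → ℝ)
    (hrep : letI := θ.instVβ₁; letI := θ.instVβ₂; letI := θ.instιβ
      ∀ k (p : Fin (k + 1) → ℝ), p ∈ Box γ₀ k → ∀ z : Pt 4,
        polLimit F (k + 1) (fun K => mergedTermFamilyMat F N (chi7 F N θ) θ.εbg k p K) θ.ρ8 θ.bV 0 1 z =
          P0 k z + limKernel (A1 k p) z)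
    (hleaves : ∀ k (p : Fin (k + 1) → ℝ), p ∈ Box γ₀ k → PolLeavesTFac190H 4 M (A1 k p) c ℓ α₂ q)
    (hC : CondsL 4 c ℓ) (h22 : c.R22gen ℓ) (hq : q.Valid c.δ₀) (hs : SignsL c α₂ q.B₃)
    (hsmall : c.ε₁ * remCoeffL 4 M c α₂ q.B₃ ≤ B12Normalization.stepBal Nc Lc)
    (hcont : letI := θ.instVβ₁; letI := θ.instVβ₂; letI := θ.instιβ
      ∀ k (z : Pt 4), ContinuousOn (fun p : Fin (k + 1) → ℝ =>
        polLimit F (k + 1) (fun K => mergedTermFamilyMat F N (chi7 F N θ) θ.εbg k p K) θ.ρ8 θ.bV 0 1 z) (Box γ₀ k)) :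
    EndpointExistence (datumOfRecord₅ F N (θ.toStage5 F N)).C.toB12 ∧
      ∃ γc : ℝ, 0 < γc ∧ BetaContH γc (datumOfRecord₅ F N (θ.toStage5 F N)).βfun := by
  letI := θ.instVβ₁; letI := θ.instVβ₂; letI := θ.instιβ
  have hres : AtSlopeCont (oneLoopSplit_stage8 F N θ) γ₀ (B12Normalization.stepBal Nc Lc) :=
    atSlopeCont_betaOfMerged F _ θ.ρ8 θ.bV _ hle P0 hβ0 hP0 A1 hrep hleaves hC h22 hq hs hsmall hcont
  refine ⟨?_, γ₀, hγ₀, ?_⟩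
  · exact endpointExistence_of_residue_atSlopeCont (datumOfRecord₅ F N (θ.toStage5 F N)).fwd (oneLoopSplit_stage8 F N θ) Js
      (fun j => hβ j) h1 hγ₀ hres
  · rw [βfun_stage8]; exact betaContH_of_atSlopeCont hres

/-- **SINGLE-PIN FORM** of `endpoint_and_n26_datumOfRecord₈` (dag-ref-D READ #34 NOTE N-n26-4): run the (D1) road in the β-layer's own channel
`(0, 1)` and take the one-loop kernels to BE the typed step kernels, `P0 k := T̄_k(·)₀₁ = TbalOf Lc Js k 0 1` — then (D1)'s pin `hβ` IS the socket's `hβ0`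
(one hypothesis, no consistency condition), (5.10) is asked of `TbalOf Lc Js k 0 1`, and `hrep` reads «merged limit kernel = one-shot step kernel + leaf sum».
[cite: Balaban1987RG1, Thm 2 p.259 (first sentence), (1.20)-(1.22) p.264 and (2.12)-(2.13) p.268; Balaban1988RG2Cluster, Lemma 3 (2.38) p.20] -/
theorem endpoint_and_n26_datumOfRecord₈_onePin (θ : Stage8Params F N) {Lc : ℕ} [NeZero Lc] (Js : ℕ → JetData 3 Lc) {Nc : ℝ}
    (hβ : letI := θ.instVβ₁; letI := θ.instVβ₂; letI := θ.instιβ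
      ∀ j, beta0OfMerged (betaMerged F (mergedTermFamilyMat F N (chi7 F N θ) θ.εbg) θ.ρ8 θ.bV) θ.v₀ j =
        B12Beta.secondMoment (TbalOf Lc Js j) 0 1)
    (h1 : D1Residue.Residue Lc Js Nc 0 1) {γ₀ : ℝ} (hγ₀ : 0 < γ₀) (hle : γ₀ ≤ θ.γ) {M : ℕ} [NeZero M]
    {c : B13.Consts} {ℓ α₂ : ℝ} {q : Consts190}
    (hP0 : ∀ k, ∃ C δ₁ : ℝ, 0 < δ₁ ∧ B12Sec2to5.Decay510 (TbalOf Lc Js k 0 1) C δ₁)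
    (A1 : (k : ℕ) → (Fin (k + 1) → ℝ) → LDom 4 → Pt 4 → ℝ)
    (hrep : letI := θ.instVβ₁; letI := θ.instVβ₂; letI := θ.instιβ
      ∀ k (p : Fin (k + 1) → ℝ), p ∈ Box γ₀ k → ∀ z : Pt 4,
        polLimit F (k + 1) (fun K => mergedTermFamilyMat F N (chi7 F N θ) θ.εbg k p K) θ.ρ8 θ.bV 0 1 z =
          TbalOf Lc Js k 0 1 z + limKernel (A1 k p) z)
    (hleaves : ∀ k (p : Fin (k + 1) → ℝ), p ∈ Box γ₀ k → PolLeavesTFac190H 4 M (A1 k p) c ℓ α₂ q)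
    (hC : CondsL 4 c ℓ) (h22 : c.R22gen ℓ) (hq : q.Valid c.δ₀) (hs : SignsL c α₂ q.B₃)
    (hsmall : c.ε₁ * remCoeffL 4 M c α₂ q.B₃ ≤ B12Normalization.stepBal Nc Lc)
    (hcont : letI := θ.instVβ₁; letI := θ.instVβ₂; letI := θ.instιβ
      ∀ k (z : Pt 4), ContinuousOn (fun p : Fin (k + 1) → ℝ =>
        polLimit F (k + 1) (fun K => mergedTermFamilyMat F N (chi7 F N θ) θ.εbg k p K) θ.ρ8 θ.bV 0 1 z) (Box γ₀ k)) :
    EndpointExistence (datumOfRecord₅ F N (θ.toStage5 F N)).C.toB12 ∧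
      ∃ γc : ℝ, 0 < γc ∧ BetaContH γc (datumOfRecord₅ F N (θ.toStage5 F N)).βfun := by
  letI := θ.instVβ₁; letI := θ.instVβ₂; letI := θ.instιβ
  -- the ONE pin, re-read as the socket's `hβ0` with `P0 k := TbalOf Lc Js k 0 1` (unfold (1.22) once; no deep unfolding of the step kernels)
  have hβ0 : ∀ k, beta0OfMerged (betaMerged F (mergedTermFamilyMat F N (chi7 F N θ) θ.εbg) θ.ρ8 θ.bV) θ.v₀ k =
      B12Beta.secondMoment (fun _ _ => TbalOf Lc Js k 0 1) 0 1 := fun k => by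
    rw [hβ k]; unfold B12Beta.secondMoment; rfl
  exact endpoint_and_n26_datumOfRecord₈ F N θ Js hβ h1 hγ₀ hle (fun k => TbalOf Lc Js k 0 1) hβ0 hP0 A1 hrep hleaves hC h22 hq
    hs hsmall hcont

/-- **N26 AT A STAGE-8 RECORD `(D, w)`** (`Node00.IsRecordOfRecord₈C F N D w`, predicate form): the box is the binding world's own small-coupling window
`]0, w.γ]` — `0 < w.γ ∧ w.γ ≤ θ.γ` is a CLAUSE OF THE RECORD PREDICATE (b2b dagwriter (B′)), so neither `0 < γ₀` nor the CAP is an extra hypothesis here —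
and the socket inputs are asked of EVERY admissible θ whose Stage-8 datum is `D` (the predicate hides θ under `∃`).  Conclusion: N26's literal
`∃ γc > 0, BetaContH γc D.βfun` at the record.  Every input a located hypothesis of NODE O; instance 0∕1; N26 NOT discharged.
[cite: Balaban1987RG1, (1.20)-(1.22) p.264; Balaban1988RG2Cluster, Lemma 3 (2.38) p.20] -/
theorem n26_of_isRecordOfRecord₈C {D : FiniteEpsData F (Matrix.specialUnitaryGroup (Fin N) ℂ)} {w : WorldP}
    (h : IsRecordOfRecord₈C F N D w)
    (hin : ∀ θ : Stage8Params F N, θ.Admissible → D = datumOfRecord₅ F N (θ.toStage5 F N) → w.γ ≤ θ.γ →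
      letI := θ.instVβ₁; letI := θ.instVβ₂; letI := θ.instιβ
      ∃ (M : ℕ) (_ : NeZero M) (c : B13.Consts) (ℓ α₂ : ℝ) (q : Consts190) (P0 : ℕ → Pt 4 → ℝ)
        (A1 : (k : ℕ) → (Fin (k + 1) → ℝ) → LDom 4 → Pt 4 → ℝ),
        (∀ k, beta0OfMerged (betaMerged F (mergedTermFamilyMat F N (chi7 F N θ) θ.εbg) θ.ρ8 θ.bV) θ.v₀ k =
          B12Beta.secondMoment (fun _ _ => P0 k) 0 1) ∧
        (∀ k, ∃ C δ₁ : ℝ, 0 < δ₁ ∧ B12Sec2to5.Decay510 (P0 k) C δ₁) ∧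
        (∀ k (p : Fin (k + 1) → ℝ), p ∈ Box w.γ k → ∀ z : Pt 4,
          polLimit F (k + 1) (fun K => mergedTermFamilyMat F N (chi7 F N θ) θ.εbg k p K) θ.ρ8 θ.bV 0 1 z =
            P0 k z + limKernel (A1 k p) z) ∧
        (∀ k (p : Fin (k + 1) → ℝ), p ∈ Box w.γ k → Nonempty (PolLeavesTFac190H 4 M (A1 k p) c ℓ α₂ q)) ∧
        CondsL 4 c ℓ ∧ c.R22gen ℓ ∧ q.Valid c.δ₀ ∧ SignsL c α₂ q.B₃ ∧
        (∀ k (z : Pt 4), ContinuousOn (fun p : Fin (k + 1) → ℝ =>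
          polLimit F (k + 1) (fun K => mergedTermFamilyMat F N (chi7 F N θ) θ.εbg k p K) θ.ρ8 θ.bV 0 1 z) (Box w.γ k))) :
    ∃ γc : ℝ, 0 < γc ∧ BetaContH γc D.βfun := by
  obtain ⟨θ, hθ, hD, -, ⟨hγ0, hγle⟩, -, -⟩ := h
  obtain ⟨M, _, c, ℓ, α₂, q, P0, A1, hβ0, hP0, hrep, hleaves, hC, h22, hq, hs, hcont⟩ := hin θ hθ hD hγle
  subst hD
  exact n26_datumOfRecord₈ F N θ hγ0 hγle P0 hβ0 hP0 A1 hrep (fun k p hp => Classical.choice (hleaves k p hp)) hC h22 hq hs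
    hcont

end Summit.QuantumFields.YangMills.Theorems.BalabanUVNodesN26AtRecord8

end
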